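import Literature.NumberTheory.EllipticCurves.ThreeIsogeny
import Literature.NumberTheory.EllipticCurves.IsogenyFrobeniusPointCount
import Literature.NumberTheory.EllipticCurves.MinimalModelReduction
import HarnessLib

/-!
# The `3`-isogeny with kernel polynomial `x`, its dual, and point counts over finite fields

Sibling file of `Literature.NumberTheory.EllipticCurves.ThreeIsogeny` (D-0014 append protocol;
everything here is proved). `ThreeIsogeny` constructs Vélu's `3`-isogeny
`E_{m,s} : y² = x³ + (mx + s)² ⟶ E_{m,s}/⟨T⟩`, `T = (0, s)` a *rational* point of order `3`.
Here we treat the general curve whose `3`-division polynomial has the rational root `x = 0`,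
i.e. whose order-`3` subgroup `{O, (0, ±√c)}` is defined over `K` without its points being
rational:

  `E : y² = x³ + ax² + bx + c` with `b² = 4ac` (`ψ₃(0) = b² - 4ac = 0`),

Vélu's quotient `E' = E/⟨(0, ±√c)⟩ = [0, a, 0, -9b, -(27c + 8ab)]`
(Vélu / Cremona, *Algorithms*, §3.8, with `t = 2b`, `w = 4c`; for `a = m²`, `b = 2ms`, `c = s²`
this is literally `ThreeIsogeny`'s `E'_{m,s} = [0, m², 0, -18ms, -(27s² + 16m³s)]`), and the
isogeny `(x, y) ↦ ((x³ + 2bx + 4c)/x², y(x³ - 2bx - 8c)/x³)` (`WeierstrassCurve.IsKernelXThreePair`,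
`IsKernelXThreePair.toIsogeny`). Over `K̄` one has `a = m²`, `c = s²`, `b = 2ms` for suitable
`m, s ∈ K̄`, so on `K̄`-points the map *is* the homomorphism of `ThreeIsogeny`
(`IsVeluThreePair.pointFun_add`, the certified additivity proof); it is defined over `K` because
its formula only involves `2b = 4ms` and `4c = 4s²`.

The point of the generalisation is twofold:
* the family is stable under quadratic twists (`[0, da, 0, d²b, d³c]`), which the CM table needs
  (`j = -12288000 ~ j = 0` and all its twists), and
* it is stable under **dualising**: the kernel `φ(E[3])` of the dual isogeny `E' → E` has kernel
  polynomial `x - x₀`, `x₀ = -4a/3` (the rational root of `ψ₃(E')`), and translating `E'` by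
  `x₀` gives `[0, a', 0, b', c']` with `a' = -3a`, `b' = 8a²/3 - 9b`, `c' = -16a³/27 + 4ab - 27c`,
  again with `b'² = 4a'c'` (`IsKernelXThreePair.dual`, stated with `a = 3e`); its Vélu quotient `E''`
  is `K`-isomorphic
  to `E` via `⟨3, 4a, 0, 0⟩` (`smul_dualCodomain_eq`: `φ̂ ∘ φ = [3]` up to this isomorphism;
  Silverman, *AEC*, III.6.1–6.2). The dual kernel `{O, (0, ±√c')}`, `c' = -3a·□`, is pointwise
  rational iff `-3a` is a square — for `E_{m,s}` iff `μ₃ ⊂ K`, as it must be by the Weil pairing.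

Consequently (`natCard_point_eq_of_isKernelXThreePair`), over a **finite** field `k` with
`char k ≠ 2, 3`: `#E(k) = #E'(k)` — by the prime-degree torsor lemma of
`IsogenyFrobeniusPointCount` applied to `φ : E → E'` and to `ψ : E'_{x₀} → E'' ≅ E` (both onto on
`k̄`-points with kernels of order `3`, `surjective_pointFun`), two out of three. This is the
instance of "isogenous curves over `𝔽_q` have equally many points" (Silverman, *AEC*,
Exercise 5.4(a); Tate 1966 Thm. 1(c)) consumed by the computation of the local factors of the CM
curves `j = -12288000 ~ j = 0` (Knapp, *Elliptic Curves*, Thm. 11.67 at the good primes).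

## References

* J. Vélu, *Isogénies entre courbes elliptiques*, C. R. Acad. Sci. Paris **273** (1971), 238–241.
  [cite: Velu1971]
* J. E. Cremona, *Algorithms for Modular Elliptic Curves*, 2nd ed. (1997), §3.8 (Vélu's formulae,
  p. 83 of the held copy). [cite: CremonaAlgorithms1997, §3.8]
* J. H. Silverman, *The Arithmetic of Elliptic Curves*, 2nd ed. (2009), III.4.12–4.13,
  III.6.1–6.2 (dual isogeny), Exercise 3.7 (`ψ₃`), Exercise 5.4(a). [cite: SilvermanAEC2009]
* A. W. Knapp, *Elliptic Curves* (1992), Thm. 11.67 (PDF pp. 281–282). [cite: Knapp1993]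

The certificates (`b'² - 4a'c' = 81(b² - 4ac)`, the coefficients of `⟨1, -4a/3, 0, 0⟩ • E'` and
of `⟨3, 4a, 0, 0⟩ • E''`) were found with Sage (generic `3`-division polynomial of `E'`:
`ψ₃ = (3x + 4a)(ax³ - 18abx - 8a²b - 27b²)/a`) and are checked here by `ring`/`linear_combination`.
-/

noncomputable section

open scoped Classical

universe u v

namespace WeierstrassCurve

/-! ## The predicate -/

section Ring

variable {R : Type u} [CommRing R] {S : Type v} [CommRing S]

/-- `IsKernelXThreePair a b c W W'` records that `W = [0, a, 0, b, c]` with `b² = 4ac` — i.e.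
`x = 0` is a root of the `3`-division polynomial `ψ₃ = 3x⁴ + 4ax³ + 6bx² + 12cx + (4ac - b²)`,
so that `{O, (0, ±√c)}` is a `K`-rational subgroup of order `3` — with `Δ(W) ≠ 0`, and that `W'`
is Vélu's quotient `[0, a, 0, -9b, -(27c + 8ab)]` (`[a₁, a₂, a₃, a₄ - 5t, a₆ - b₂t - 7w]` with
`t = 2·(3x_T² + 2a x_T + b) = 2b`, `w = 4y_T² = 4c` at `x_T = 0`). Vélu (1971); Cremona,
*Algorithms*, §3.8; Silverman, *AEC*, Exercise 3.7.
[cite: CremonaAlgorithms1997, §3.8 (Vélu's formulae for an l-isogeny, p. 83 of the held copy)] -/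
structure IsKernelXThreePair (a b c : R) (W W' : WeierstrassCurve R) : Prop where
  a₁_eq : W.a₁ = 0
  a₂_eq : W.a₂ = a
  a₃_eq : W.a₃ = 0
  a₄_eq : W.a₄ = b
  a₆_eq : W.a₆ = c
  a₁'_eq : W'.a₁ = 0
  a₂'_eq : W'.a₂ = a
  a₃'_eq : W'.a₃ = 0
  a₄'_eq : W'.a₄ = -9 * b
  a₆'_eq : W'.a₆ = -(27 * c + 8 * a * b)
  rel : b ^ 2 = 4 * a * c
  Δ_ne : W.Δ ≠ 0

/-- Vélu's quotient `[0, a, 0, -9b, -(27c + 8ab)]` of `[0, a, 0, b, c]` by `{O, (0, ±√c)}`.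
Cremona, *Algorithms*, §3.8. [folklore] -/
def kernelXThreeCodomain (a b c : R) : WeierstrassCurve R :=
  ⟨0, a, 0, -9 * b, -(27 * c + 8 * a * b)⟩

/-- `a₁ = 0` for Vélu's quotient. [folklore] -/
@[simp] theorem kernelXThreeCodomain_a₁ (a b c : R) : (kernelXThreeCodomain a b c).a₁ = 0 := rfl

/-- `a₂ = a` for Vélu's quotient. [folklore] -/
@[simp] theorem kernelXThreeCodomain_a₂ (a b c : R) : (kernelXThreeCodomain a b c).a₂ = a := rfl

/-- `a₃ = 0` for Vélu's quotient. [folklore] -/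
@[simp] theorem kernelXThreeCodomain_a₃ (a b c : R) : (kernelXThreeCodomain a b c).a₃ = 0 := rfl

/-- `a₄ = -9b` for Vélu's quotient (`a₄ - 5t`, `t = 2b`). [folklore] -/
@[simp] theorem kernelXThreeCodomain_a₄ (a b c : R) :
    (kernelXThreeCodomain a b c).a₄ = -9 * b := rfl

/-- `a₆ = -(27c + 8ab)` for Vélu's quotient (`a₆ - b₂t - 7w`, `b₂ = 4a`, `t = 2b`, `w = 4c`).
[folklore] -/
@[simp] theorem kernelXThreeCodomain_a₆ (a b c : R) :
    (kernelXThreeCodomain a b c).a₆ = -(27 * c + 8 * a * b) := rfl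

/-- The literal pair `[0, a, 0, b, c] → [0, a, 0, -9b, -(27c + 8ab)]` satisfies the predicate
when `b² = 4ac` and `Δ ≠ 0`. [folklore] -/
theorem isKernelXThreePair_mk {a b c : R} (hrel : b ^ 2 = 4 * a * c)
    (hΔ : (⟨0, a, 0, b, c⟩ : WeierstrassCurve R).Δ ≠ 0) :
    IsKernelXThreePair a b c ⟨0, a, 0, b, c⟩ (kernelXThreeCodomain a b c) :=
  ⟨rfl, rfl, rfl, rfl, rfl, rfl, rfl, rfl, rfl, rfl, hrel, hΔ⟩

/-- A Vélu pair `E_{m,s} → E'_{m,s}` of `ThreeIsogeny` is a kernel-`x` pair with `a = m²`,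
`b = 2ms`, `c = s²`. [folklore] -/
theorem IsVeluThreePair.isKernelXThreePair {m s : R} {W W' : WeierstrassCurve R}
    (h : IsVeluThreePair m s W W') : IsKernelXThreePair (m ^ 2) (2 * m * s) (s ^ 2) W W' where
  a₁_eq := h.a₁_eq
  a₂_eq := h.a₂_eq
  a₃_eq := h.a₃_eq
  a₄_eq := h.a₄_eq
  a₆_eq := h.a₆_eq
  a₁'_eq := h.a₁'_eq
  a₂'_eq := h.a₂'_eq
  a₃'_eq := h.a₃'_eq
  a₄'_eq := by rw [h.a₄'_eq]; ring
  a₆'_eq := by rw [h.a₆'_eq]; ring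
  rel := by ring
  Δ_ne := h.Δ_ne

namespace IsKernelXThreePair

variable {a b c : R} {W W' : WeierstrassCurve R}

/-- `Δ(W) = 8(b³ - 54c²)` on the family `b² = 4ac` (`b₈ = 4ac - b² = 0`). [folklore] -/
theorem Δ_eq (h : IsKernelXThreePair a b c W W') : W.Δ = 8 * b ^ 3 - 432 * c ^ 2 := by
  simp only [Δ, b₂, b₄, b₆, b₈, h.a₁_eq, h.a₂_eq, h.a₃_eq, h.a₄_eq, h.a₆_eq]
  linear_combination ((16 : R) * a ^ 2 - 72 * b) * h.rel

/-- The affine equation of `W`: `y² = x³ + ax² + bx + c`. [folklore] -/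
theorem equation_iff (h : IsKernelXThreePair a b c W W') (x y : R) :
    W.toAffine.Equation x y ↔ y ^ 2 = x ^ 3 + a * x ^ 2 + b * x + c := by
  rw [Affine.equation_iff, h.a₁_eq, h.a₂_eq, h.a₃_eq, h.a₄_eq, h.a₆_eq]
  constructor <;> intro e <;> linear_combination e

/-- The predicate is stable under ring homomorphisms. [folklore] -/
theorem map (h : IsKernelXThreePair a b c W W') (f : R →+* S) (hΔ : (W.map f).Δ ≠ 0) :
    IsKernelXThreePair (f a) (f b) (f c) (W.map f) (W'.map f) where
  a₁_eq := by simp [h.a₁_eq]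
  a₂_eq := by simp [h.a₂_eq]
  a₃_eq := by simp [h.a₃_eq]
  a₄_eq := by simp [h.a₄_eq]
  a₆_eq := by simp [h.a₆_eq]
  a₁'_eq := by simp [h.a₁'_eq]
  a₂'_eq := by simp [h.a₂'_eq]
  a₃'_eq := by simp [h.a₃'_eq]
  a₄'_eq := by simp [h.a₄'_eq, map_ofNat]
  a₆'_eq := by simp [h.a₆'_eq, map_ofNat]
  rel := by rw [← map_pow, h.rel]; simp [map_ofNat]
  Δ_ne := hΔ

/-- If `a = m²`, `c = s²` and `b = 2ms`, a kernel-`x` pair is a Vélu pair `E_{m,s} → E'_{m,s}`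
of `ThreeIsogeny`. [folklore] -/
theorem isVeluThreePair (h : IsKernelXThreePair a b c W W') {m s : R} (hm : a = m ^ 2)
    (hs : c = s ^ 2) (hb : b = 2 * m * s) : IsVeluThreePair m s W W' where
  a₁_eq := h.a₁_eq
  a₂_eq := by rw [h.a₂_eq, hm]
  a₃_eq := h.a₃_eq
  a₄_eq := by rw [h.a₄_eq, hb]
  a₆_eq := by rw [h.a₆_eq, hs]
  a₁'_eq := h.a₁'_eq
  a₂'_eq := by rw [h.a₂'_eq, hm]
  a₃'_eq := h.a₃'_eq
  a₄'_eq := by rw [h.a₄'_eq, hb]; ring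
  a₆'_eq := by rw [h.a₆'_eq, hs, hm, hb]; ring
  Δ_ne := h.Δ_ne

end IsKernelXThreePair

end Ring

/-! ## Over a field: `char ≠ 2`, `c ≠ 0`, and the Vélu data over an algebraically closed field -/

section Field

variable {F : Type u} [Field F] {a b c : F} {W W' : WeierstrassCurve F}

namespace IsKernelXThreePair

/-- `char F ≠ 2` (`Δ = 8(b³ - 54c²)`). [folklore] -/
theorem two_ne (h : IsKernelXThreePair a b c W W') : (2 : F) ≠ 0 := by
  intro h2
  apply h.Δ_ne
  rw [h.Δ_eq]
  linear_combination ((4 : F) * b ^ 3 - 216 * c ^ 2) * h2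

/-- `c ≠ 0` (else `b = 0` and `Δ = 0`). [folklore] -/
theorem c_ne (h : IsKernelXThreePair a b c W W') : c ≠ 0 := by
  intro hc
  have hb : b = 0 := by
    have := h.rel
    rw [hc, mul_zero] at this
    exact pow_eq_zero_iff two_ne_zero |>.mp this
  apply h.Δ_ne
  rw [h.Δ_eq, hb, hc]
  ring

/-- The base change of the pair to an extension field. [folklore] -/
theorem baseChange (h : IsKernelXThreePair a b c W W') (L : Type v) [Field L] [Algebra F L] :
    IsKernelXThreePair (algebraMap F L a) (algebraMap F L b) (algebraMap F L c)
      (W.baseChange L) (W'.baseChange L) :=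
  h.map (algebraMap F L) (by simpa [map_Δ] using h.Δ_ne)

/-- **Over an algebraically closed field the kernel points are rational**: there are `m, s`
with `a = m²`, `c = s²`, `b = 2ms` (take `m = √a`; `s = b/2m` if `m ≠ 0`, and `s = √c` if
`a = b = 0`), so the pair is a Vélu pair `E_{m,s} → E'_{m,s}`. [folklore] -/
theorem exists_isVeluThreePair [IsAlgClosed F] (h : IsKernelXThreePair a b c W W') :
    ∃ m s : F, IsVeluThreePair m s W W' := by
  obtain ⟨m, hm⟩ := IsAlgClosed.exists_pow_nat_eq a two_pos
  by_cases hm0 : m = 0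
  · have ha : a = 0 := by rw [← hm, hm0]; ring
    have hb : b = 0 := by
      have := h.rel
      rw [ha, mul_zero, zero_mul] at this
      exact pow_eq_zero_iff two_ne_zero |>.mp this
    obtain ⟨s, hs⟩ := IsAlgClosed.exists_pow_nat_eq c two_pos
    exact ⟨m, s, h.isVeluThreePair hm.symm hs.symm (by rw [hb, hm0]; ring)⟩
  · have h2m : 2 * m ≠ 0 := mul_ne_zero h.two_ne hm0
    refine ⟨m, b / (2 * m), h.isVeluThreePair hm.symm ?_ ?_⟩
    · have hrel := h.rel
      rw [← hm] at hrel
      rw [div_pow, eq_div_iff (pow_ne_zero _ h2m)]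
      linear_combination -hrel
    · rw [mul_div_cancel₀ _ h2m]

end IsKernelXThreePair

end Field

/-! ## The isogeny on geometric points -/

section Isogeny

open MvPolynomial

variable {K : Type u} [Field K] {a b c : K} {W W' : WeierstrassCurve K}

namespace IsKernelXThreePair

/-- The pair over `K̄`. [folklore] -/
theorem geomPair (h : IsKernelXThreePair a b c W W') :
    IsKernelXThreePair (algebraMap K (AlgebraicClosure K) a) (algebraMap K (AlgebraicClosure K) b)
      (algebraMap K (AlgebraicClosure K) c) (W.baseChange (AlgebraicClosure K))
      (W'.baseChange (AlgebraicClosure K)) :=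
  h.baseChange _

/-- A chosen `m ∈ K̄` with `m² = a` (part of the Vélu data over `K̄`). [folklore] -/
def gm (h : IsKernelXThreePair a b c W W') : AlgebraicClosure K :=
  h.geomPair.exists_isVeluThreePair.choose

/-- A chosen `s ∈ K̄` with `s² = c`, `2ms = b`. [folklore] -/
def gs (h : IsKernelXThreePair a b c W W') : AlgebraicClosure K :=
  h.geomPair.exists_isVeluThreePair.choose_spec.choose

/-- **Over `K̄` the pair is the Vélu pair `E_{m,s} → E'_{m,s}`** for the chosen `m = gm`,
`s = gs`. [folklore] -/
theorem geom (h : IsKernelXThreePair a b c W W') :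
    IsVeluThreePair h.gm h.gs (W.baseChange (AlgebraicClosure K))
      (W'.baseChange (AlgebraicClosure K)) :=
  h.geomPair.exists_isVeluThreePair.choose_spec.choose_spec

/-- `4 m s = 2b` in `K̄`. [folklore] -/
theorem four_mul_gm_mul_gs (h : IsKernelXThreePair a b c W W') :
    4 * h.gm * h.gs = 2 * algebraMap K (AlgebraicClosure K) b := by
  have e := h.geom.a₄_eq
  rw [WeierstrassCurve.baseChange, map_a₄, h.a₄_eq] at e
  linear_combination (-2 : AlgebraicClosure K) * e

/-- `s² = c` in `K̄`. [folklore] -/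
theorem gs_sq (h : IsKernelXThreePair a b c W W') :
    h.gs ^ 2 = algebraMap K (AlgebraicClosure K) c := by
  have e := h.geom.a₆_eq
  rw [WeierstrassCurve.baseChange, map_a₆, h.a₆_eq] at e
  exact e.symm

/-- The `x`-coordinate of the isogeny in `K`-rational form: `X(x) = (x³ + 2bx + 4c)/x²`.
[folklore] -/
theorem geom_X (h : IsKernelXThreePair a b c W W') (x : AlgebraicClosure K) :
    h.geom.X x = (x ^ 3 + 2 * algebraMap K (AlgebraicClosure K) b * x +
      4 * algebraMap K (AlgebraicClosure K) c) / x ^ 2 := by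
  rw [IsVeluThreePair.X, ← h.gs_sq, ← h.four_mul_gm_mul_gs]

/-- The `y`-coordinate of the isogeny in `K`-rational form: `Y(x, y) = y(x³ - 2bx - 8c)/x³`.
[folklore] -/
theorem geom_Y (h : IsKernelXThreePair a b c W W') (x y : AlgebraicClosure K) :
    h.geom.Y x y = y * (x ^ 3 - 2 * algebraMap K (AlgebraicClosure K) b * x -
      8 * algebraMap K (AlgebraicClosure K) c) / x ^ 3 := by
  rw [IsVeluThreePair.Y, ← h.gs_sq, ← h.four_mul_gm_mul_gs]

/-- The kernel generator `T = (0, s)` as a geometric point. [folklore] -/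
def geomT (h : IsKernelXThreePair a b c W W') : W.geomPoints :=
  h.geom.T

/-- `T ≠ O`. [folklore] -/
theorem geomT_ne_zero (h : IsKernelXThreePair a b c W W') : h.geomT ≠ 0 :=
  h.geom.T_ne_zero

/-- `T ≠ -T`. [folklore] -/
theorem geomT_ne_neg (h : IsKernelXThreePair a b c W W') : h.geomT ≠ -h.geomT :=
  h.geom.T_ne_neg_T

/-- The isogeny on geometric points `E(K̄) →+ E'(K̄)`: Vélu's homomorphism for the chosen
`m, s` (`ThreeIsogeny`, `IsVeluThreePair.pointHom`). [folklore] -/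
def geomHom (h : IsKernelXThreePair a b c W W') : W.geomPoints →+ W'.geomPoints where
  toFun := h.geom.pointFun
  map_zero' := h.geom.pointFun_zero
  map_add' := h.geom.pointFun_add

/-- Unfolding `geomHom`. [folklore] -/
theorem geomHom_apply (h : IsKernelXThreePair a b c W W') (P : W.geomPoints) :
    h.geomHom P = h.geom.pointFun P := rfl

/-- The isogeny is given by the rational map `((x³ + 2bx + 4c)/x², y(x³ - 2bx - 8c)/x³)` off
`{O, ±T}`. Vélu (1971). [folklore] -/
theorem isAlgebraicOn_geomHom (h : IsKernelXThreePair a b c W W') :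
    IsAlgebraicOn W W' h.geomHom := by
  refine ⟨MvPolynomial.X 0 ^ 3 + C (2 * algebraMap K (AlgebraicClosure K) b) * MvPolynomial.X 0 +
      C (4 * algebraMap K (AlgebraicClosure K) c),
    MvPolynomial.X 0 ^ 2,
    MvPolynomial.X 1 * (MvPolynomial.X 0 ^ 3 - C (2 * algebraMap K (AlgebraicClosure K) b) *
      MvPolynomial.X 0 - C (8 * algebraMap K (AlgebraicClosure K) c)),
    MvPolynomial.X 0 ^ 3, ?_⟩
  refine (((Set.finite_singleton (-h.geomT)).insert h.geomT).insert (0 : W.geomPoints)).subset ?_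
  intro P hP
  by_contra hPT
  apply hP
  have hP0 : P ≠ 0 := fun hh => hPT (by rw [hh]; exact Set.mem_insert _ _)
  have hPT' : P ≠ h.geomT := fun hh =>
    hPT (by rw [hh]; exact Set.mem_insert_of_mem _ (Set.mem_insert _ _))
  have hPnT : P ≠ -h.geomT := fun hh =>
    hPT (by rw [hh]; exact Set.mem_insert_of_mem _ (Set.mem_insert_of_mem _ (Set.mem_singleton _)))
  rcases P with _ | ⟨x, y, hxy⟩
  · exact absurd rfl hP0
  · have hx : x ≠ 0 := by
      intro hx
      rcases h.geom.some_eq_T_or hxy hx with hh | hh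
      exacts [hPT' hh, hPnT hh]
    have hns := h.geom.nonsingular_image hxy hx
    refine ⟨x, y, hxy, rfl, by simpa using pow_ne_zero 2 hx, by simpa using pow_ne_zero 3 hx, ?_⟩
    rw [h.geom_X, h.geom_Y] at hns
    refine ⟨by simpa using hns, ?_⟩
    rw [geomHom_apply, h.geom.pointFun_some _ hx]
    congr 1 <;> simp [h.geom_X, h.geom_Y]

/-- The isogeny is defined over `K`: it commutes with `Γ_K` (its formula has coefficients
`2b, 4c, 8c ∈ K`). Silverman, *AEC*, III.4.12–4.13 (Remark 4.13.2). [folklore] -/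
theorem geomHom_smul (h : IsKernelXThreePair a b c W W') (σ : Field.absoluteGaloisGroup K)
    (P : W.geomPoints) : h.geomHom (σ • P) = σ • h.geomHom P := by
  set τ : AlgebraicClosure K →ₐ[K] AlgebraicClosure K :=
    ((show AlgebraicClosure K ≃ₐ[K] AlgebraicClosure K from σ) :
      AlgebraicClosure K →ₐ[K] AlgebraicClosure K) with hτ
  rcases P with _ | ⟨x, y, hxy⟩
  · show h.geomHom (σ • (0 : W.geomPoints)) = σ • h.geomHom 0
    rw [smul_zero, map_zero, smul_zero]
  · show h.geom.pointFun (Affine.Point.map τ (Affine.Point.some x y hxy)) =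
      Affine.Point.map τ (h.geom.pointFun (Affine.Point.some x y hxy))
    rw [Affine.Point.map_some]
    by_cases hx : x = 0
    · have hσx : τ x = 0 := by rw [hx, map_zero]
      rw [h.geom.pointFun_some_of_eq_zero _ hσx, h.geom.pointFun_some_of_eq_zero _ hx,
        Affine.Point.map_zero]
    · have hσx : τ x ≠ 0 := (map_ne_zero τ).mpr hx
      rw [h.geom.pointFun_some _ hσx, h.geom.pointFun_some _ hx, Affine.Point.map_some]
      congr 1 <;> simp [h.geom_X, h.geom_Y, map_div₀, map_ofNat, AlgHom.commutes]

/-- The kernel on `E(K̄)` is `{O, T, -T}`. Vélu (1971). [folklore] -/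
theorem ker_geomHom (h : IsKernelXThreePair a b c W W') :
    (h.geomHom.ker : Set W.geomPoints) = {0, h.geomT, -h.geomT} := by
  ext P
  exact h.geom.pointFun_eq_zero_iff P

/-- **The `3`-isogeny with kernel polynomial `x`**, `φ : E = [0, a, 0, b, c] → E' = [0, a, 0, -9b,
-(27c + 8ab)]` (`b² = 4ac`), as a term of the prelude's `Isogeny W W'`: Vélu's homomorphism
`(x, y) ↦ ((x³ + 2bx + 4c)/x², y(x³ - 2bx - 8c)/x³)` on `K̄`-points (there equal to the
`ThreeIsogeny` map of `E_{m,s}`), algebraic off `{O, ±T}`, `Γ_K`-equivariant, kernel `{O, ±T}`,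
`T = (0, √c)`. Vélu (1971); Cremona, *Algorithms*, §3.8; Silverman, *AEC*, III.4.12–4.13.
[cite: CremonaAlgorithms1997, §3.8 (Vélu's formulae)] -/
def toIsogeny (h : IsKernelXThreePair a b c W W') : Isogeny W W' where
  toAddMonoidHom := h.geomHom
  isAlgebraic := h.isAlgebraicOn_geomHom
  equivariant := h.geomHom_smul
  finite_ker := by
    rw [ker_geomHom]
    exact ((Set.finite_singleton _).insert _).insert 0

/-- Unfolding `toIsogeny` on points. [folklore] -/
@[simp] theorem toIsogeny_apply (h : IsKernelXThreePair a b c W W') (P : W.geomPoints) :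
    h.toIsogeny P = h.geom.pointFun P := rfl

/-- **The isogeny has degree `3`**: `#ker = #{O, T, -T} = 3`. Vélu (1971). [folklore] -/
theorem natCard_ker_toIsogeny (h : IsKernelXThreePair a b c W W') :
    Nat.card h.toIsogeny.toAddMonoidHom.ker = 3 := by
  have e : (h.toIsogeny.toAddMonoidHom.ker : Set W.geomPoints) = {0, h.geomT, -h.geomT} :=
    h.ker_geomHom
  rw [← SetLike.coe_sort_coe, e, Nat.card_coe_set_eq]
  have h1 : (0 : W.geomPoints) ∉ ({h.geomT, -h.geomT} : Set W.geomPoints) := by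
    simp only [Set.mem_insert_iff, Set.mem_singleton_iff, not_or]
    exact ⟨h.geomT_ne_zero.symm, fun h0 => h.geomT_ne_zero (neg_eq_zero.mp h0.symm)⟩
  rw [Set.ncard_insert_of_notMem h1, Set.ncard_pair h.geomT_ne_neg]

/-- **`E ~ E'`.** [folklore] -/
theorem isIsogenous (h : IsKernelXThreePair a b c W W') : IsIsogenous W W' :=
  ⟨h.toIsogeny⟩

end IsKernelXThreePair

end Isogeny

/-! ## Surjectivity of Vélu's `3`-isogeny on points over an algebraically closed field -/

section Surjective

open Polynomial

variable {F : Type u} [Field F] [IsAlgClosed F] {m s : F} {W W' : WeierstrassCurve F}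

/-- Over an algebraically closed field, the monic cubic `x³ - e x² + p x + q` with `q ≠ 0` has a
root, necessarily non-zero. [folklore] -/
theorem exists_root_cubic_ne_zero (e p : F) {q : F} (hq : q ≠ 0) :
    ∃ x : F, x ≠ 0 ∧ x ^ 3 - e * x ^ 2 + p * x + q = 0 := by
  obtain ⟨x, hx⟩ := IsAlgClosed.exists_root (X ^ 3 - C e * X ^ 2 + C p * X + C q : F[X]) (by
    rw [show (X ^ 3 - C e * X ^ 2 + C p * X + C q : F[X]).degree = 3 by compute_degree!]
    norm_num)
  simp only [IsRoot.def, eval_add, eval_sub, eval_pow, eval_X, eval_mul, eval_C] at hx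
  refine ⟨x, fun h0 ↦ hq ?_, hx⟩
  rw [h0] at hx
  simpa using hx

/-- **Vélu's `3`-isogeny is onto on points over an algebraically closed field**: for
`(X, Y) ∈ E'(F)`, a root `x ≠ 0` of `x³ - Xx² + 4msx + 4s² = 0` has `X(x) = X`, and for
`y = √(x³ + (mx + s)²)` one of `(x, ±y)` maps to `(X, Y)`. Silverman, *AEC*, II.2.3. [folklore] -/
theorem IsVeluThreePair.pointFun_surjective (h : IsVeluThreePair m s W W') :
    Function.Surjective h.pointFun := by
  haveI : W.IsElliptic := ⟨isUnit_iff_ne_zero.mpr h.Δ_ne⟩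
  rintro (_ | ⟨X, Y, hQ⟩)
  · exact ⟨0, rfl⟩
  have h4 : (4 : F) * s ^ 2 ≠ 0 := by
    refine mul_ne_zero ?_ (pow_ne_zero _ h.s_ne)
    rw [show (4 : F) = 2 ^ 2 by norm_num]
    exact pow_ne_zero _ h.two_ne
  obtain ⟨x, hx, hroot⟩ := exists_root_cubic_ne_zero X (4 * m * s) h4
  have hX : h.X x = X := by
    rw [IsVeluThreePair.X, div_eq_iff (pow_ne_zero _ hx)]
    linear_combination hroot
  obtain ⟨y, hy⟩ := IsAlgClosed.exists_pow_nat_eq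
    (x ^ 3 + m ^ 2 * x ^ 2 + 2 * m * s * x + s ^ 2) two_pos
  have heq : W.toAffine.Equation x y := (h.equation_iff x y).mpr hy
  have hns : W.toAffine.Nonsingular x y := (Affine.equation_iff_nonsingular).mp heq
  have himg := h.equation_image heq hx
  rw [hX, h.equation'_iff] at himg
  have hQ' := (h.equation'_iff X Y).mp hQ.left
  have hsq : h.Y x y ^ 2 = Y ^ 2 := by rw [himg, hQ']
  rcases sq_eq_sq_iff_eq_or_eq_neg.mp hsq with hs | hs
  · refine ⟨.some x y hns, ?_⟩
    rw [h.pointFun_some hns hx]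
    have hc : h.X x = X ∧ h.Y x y = Y := ⟨hX, hs⟩
    obtain ⟨rfl, rfl⟩ := hc
    rfl
  · have hns' : W.toAffine.Nonsingular x (-y) := by
      rw [← h.negY_eq x y]
      exact (Affine.nonsingular_neg x y).mpr hns
    have hs' : h.Y x (-y) = Y := by
      rw [show h.Y x (-y) = -h.Y x y by simp only [IsVeluThreePair.Y]; ring, hs, neg_neg]
    refine ⟨.some x (-y) hns', ?_⟩
    rw [h.pointFun_some hns' hx]
    have hc : h.X x = X ∧ h.Y x (-y) = Y := ⟨hX, hs'⟩
    obtain ⟨rfl, rfl⟩ := hc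
    rfl

end Surjective

/-! ## The dual data -/

section Dual

variable {K : Type u} [Field K] {a b c e : K} {W W' : WeierstrassCurve K}

namespace IsKernelXThreePair

/-- `Δ(W') ≠ 0`: the quotient is elliptic (read off over `K̄`, where it is `E'_{m,s}`). [folklore] -/
theorem Δ'_ne (h : IsKernelXThreePair a b c W W') : W'.Δ ≠ 0 := by
  have e := h.geom.Δ'_ne
  rw [WeierstrassCurve.baseChange, map_Δ] at e
  exact fun h0 ↦ e (by rw [h0, map_zero])

/-- The isogeny `toIsogeny` is onto on `K̄`-points. [folklore] -/
theorem toIsogeny_surjective (h : IsKernelXThreePair a b c W W') :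
    Function.Surjective h.toIsogeny :=
  h.geom.pointFun_surjective

/-- **The dual data.** For a kernel-`x` pair `E = [0, a, 0, b, c] → E'`, `a = 3e`, translating
`E'` by the rational root `x₀ = -4a/3 = -4e` of its `3`-division polynomial gives
`⟨1, -4e, 0, 0⟩ • E' = [0, a', 0, b', c']` with `a' = -3a = -9e`, `b' = 8a²/3 - 9b = 24e² - 9b`,
`c' = -16a³/27 + 4ab - 27c = -16e³ + 12eb - 27c`, and again `b'² = 4a'c'`
(`b'² - 4a'c' = 81(b² - 4ac)`): the subgroup `φ(E[3]) = {O, (x₀, ±√c')}` of `E'` — the kernel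
of the dual isogeny — has kernel polynomial `x - x₀`. So
`[0, a', 0, b', c'] → [0, a', 0, -9b', -(27c' + 8a'b')]` is again a kernel-`x` pair.
Silverman, *AEC*, III.6.1 (dual isogeny) with Exercise 3.7 (`ψ₃`); Vélu (1971). [folklore] -/
theorem dual (h : IsKernelXThreePair (3 * e) b c W W') :
    IsKernelXThreePair (-9 * e) (24 * e ^ 2 - 9 * b) (-16 * e ^ 3 + 12 * e * b - 27 * c)
      ((⟨1, -4 * e, 0, 0⟩ : VariableChange K) • W')
      (kernelXThreeCodomain (-9 * e) (24 * e ^ 2 - 9 * b) (-16 * e ^ 3 + 12 * e * b - 27 * c)) where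
  a₁_eq := by simp [variableChange_a₁, h.a₁'_eq]
  a₂_eq := by
    simp only [variableChange_a₂, h.a₁'_eq, h.a₂'_eq, inv_one, Units.val_one]
    ring
  a₃_eq := by simp [variableChange_a₃, h.a₁'_eq, h.a₃'_eq]
  a₄_eq := by
    simp only [variableChange_a₄, h.a₁'_eq, h.a₂'_eq, h.a₃'_eq, h.a₄'_eq, inv_one, Units.val_one]
    ring
  a₆_eq := by
    simp only [variableChange_a₆, h.a₁'_eq, h.a₂'_eq, h.a₃'_eq, h.a₄'_eq, h.a₆'_eq, inv_one,
      Units.val_one]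
    ring
  a₁'_eq := rfl
  a₂'_eq := rfl
  a₃'_eq := rfl
  a₄'_eq := rfl
  a₆'_eq := rfl
  rel := by linear_combination (81 : K) * h.rel
  Δ_ne := by
    simp only [variableChange_Δ, inv_one, Units.val_one, one_pow, one_mul]
    exact h.Δ'_ne

/-- **`φ̂ ∘ φ = [3]` up to isomorphism: `E = ⟨3, 4a, 0, 0⟩ • E''`** (`a = 3e`, `3 ≠ 0`), where
`E''` is the Vélu quotient of the translated `E'` by the dual kernel. Silverman, *AEC*,
III.6.1–6.2. [folklore] -/
theorem smul_dualCodomain_eq (h : IsKernelXThreePair (3 * e) b c W W') (h3 : (3 : K) ≠ 0) :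
    (⟨Units.mk0 3 h3, 12 * e, 0, 0⟩ : VariableChange K) •
        kernelXThreeCodomain (-9 * e) (24 * e ^ 2 - 9 * b) (-16 * e ^ 3 + 12 * e * b - 27 * c) =
      W := by
  ext
  · simp [variableChange_a₁, h.a₁_eq]
  · simp only [variableChange_a₂, kernelXThreeCodomain_a₁, kernelXThreeCodomain_a₂,
      Units.val_inv_eq_inv_val, Units.val_mk0, h.a₂_eq]
    field_simp
    ring
  · simp [variableChange_a₃, h.a₃_eq]
  · simp only [variableChange_a₄, kernelXThreeCodomain_a₁, kernelXThreeCodomain_a₂,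
      kernelXThreeCodomain_a₃, kernelXThreeCodomain_a₄, Units.val_inv_eq_inv_val, Units.val_mk0,
      h.a₄_eq]
    field_simp
    ring
  · simp only [variableChange_a₆, kernelXThreeCodomain_a₁, kernelXThreeCodomain_a₂,
      kernelXThreeCodomain_a₃, kernelXThreeCodomain_a₄, kernelXThreeCodomain_a₆,
      Units.val_inv_eq_inv_val, Units.val_mk0, h.a₆_eq]
    field_simp
    ring

end IsKernelXThreePair

end Dual

/-! ## Point counts over a finite field -/

section Finite

open IsogenyPointCount

variable {K : Type u} [Field K] [Finite K] {a b c : K} {W W' : WeierstrassCurve K}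

/-- Two-out-of-three with isomorphisms: if `φ : E → E'` and `ψ : V → V''` are isogenies over
the finite field `k`, onto on `k̄`-points, with kernels of prime orders `ℓ, ℓ'`, and
`#V(k) = #E'(k)`, `#V''(k) = #E(k)`, then `#E(k) = #E'(k)` (`n ∈ {n', ℓn'}`, `n' ∈ {n, ℓ'n}`,
`n ≥ 1`). Variant of `natCard_point_eq_of_isogeny_of_isogeny`. [folklore] -/
theorem natCard_point_eq_of_isogeny_of_isogeny' {V V'' : WeierstrassCurve K} (φ : Isogeny W W')
    (ψ : Isogeny V V'') (hφ : Function.Surjective φ) (hψ : Function.Surjective ψ) {ℓ ℓ' : ℕ}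
    (hℓ : ℓ.Prime) (hℓ' : ℓ'.Prime) (hkerφ : Nat.card φ.toAddMonoidHom.ker = ℓ)
    (hkerψ : Nat.card ψ.toAddMonoidHom.ker = ℓ')
    (hV : Nat.card V.toAffine.Point = Nat.card W'.toAffine.Point)
    (hV'' : Nat.card V''.toAffine.Point = Nat.card W.toAffine.Point) :
    Nat.card W.toAffine.Point = Nat.card W'.toAffine.Point := by
  have hn := natCard_point_ne_zero W
  rcases φ.natCard_point_eq_or_eq_mul_of_surjective hφ hℓ hkerφ with h₁ | h₁
  · exact h₁
  rcases ψ.natCard_point_eq_or_eq_mul_of_surjective hψ hℓ' hkerψ with h₂ | h₂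
  · rw [hV, hV''] at h₂
    rw [h₂] at h₁
    have : Nat.card W.toAffine.Point * (ℓ - 1) = 0 := by
      have hl := hℓ.one_lt.le
      zify [hl] at h₁ ⊢
      linear_combination -h₁
    rcases Nat.mul_eq_zero.mp this with h0 | h0
    · exact absurd h0 hn
    · exact absurd h0 (Nat.sub_ne_zero_of_lt hℓ.one_lt)
  · rw [hV, hV''] at h₂
    rw [h₂] at h₁
    have : Nat.card W.toAffine.Point * (ℓ * ℓ' - 1) = 0 := by
      have hl : 1 ≤ ℓ * ℓ' := Nat.one_le_iff_ne_zero.mpr (mul_ne_zero hℓ.ne_zero hℓ'.ne_zero)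
      zify [hl] at h₁ ⊢
      linear_combination -h₁
    rcases Nat.mul_eq_zero.mp this with h0 | h0
    · exact absurd h0 hn
    · have : 1 < ℓ * ℓ' := lt_of_lt_of_le hℓ.one_lt (Nat.le_mul_of_pos_right _ hℓ'.pos)
      exact absurd h0 (Nat.sub_ne_zero_of_lt this)

/-- **`#E(k) = #E'(k)` for the `3`-isogeny with kernel polynomial `x` over a finite field** `k`
with `char k ≠ 2, 3` (`E = [0, a, 0, b, c]`, `b² = 4ac`, `Δ ≠ 0`; `E' = [0, a, 0, -9b,
-(27c + 8ab)]`): isogenous elliptic curves over a finite field have the same number of rational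
points (Silverman, *AEC*, Exercise 5.4(a); the input of Knapp's proof of Thm. 11.67 at the good
primes). Proof: the prime-degree torsor lemma for `φ : E → E'` and for the isogeny of dual type
`ψ : ⟨1, -4a/3, 0, 0⟩ • E' → E'' ≅ E` (`dual`, `smul_dualCodomain_eq`), two out of three.
[cite: SilvermanAEC2009, Exercise 5.4(a) (p. 139)] -/
theorem natCard_point_eq_of_isKernelXThreePair (h : IsKernelXThreePair a b c W W')
    (h3 : (3 : K) ≠ 0) : Nat.card W.toAffine.Point = Nat.card W'.toAffine.Point := by
  obtain ⟨e, rfl⟩ : ∃ e, a = 3 * e := ⟨a / 3, by field_simp⟩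
  refine natCard_point_eq_of_isogeny_of_isogeny' h.toIsogeny h.dual.toIsogeny
    h.toIsogeny_surjective h.dual.toIsogeny_surjective Nat.prime_three Nat.prime_three
    h.natCard_ker_toIsogeny h.dual.natCard_ker_toIsogeny (natCard_point_smul _ _) ?_
  conv_rhs => rw [← h.smul_dualCodomain_eq h3]
  exact (natCard_point_smul _ _).symm

/-- Literal form: for `a, b, c` in a finite field `k` of characteristic `≠ 2, 3` with
`b² = 4ac` and `Δ([0, a, 0, b, c]) ≠ 0`,
`#[0, a, 0, b, c](k) = #[0, a, 0, -9b, -(27c + 8ab)](k)`.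
[cite: SilvermanAEC2009, Exercise 5.4(a)] -/
theorem natCard_point_kernelXThree_eq (a b c : K) (hrel : b ^ 2 = 4 * a * c)
    (hΔ : (⟨0, a, 0, b, c⟩ : WeierstrassCurve K).Δ ≠ 0) (h3 : (3 : K) ≠ 0) :
    Nat.card (⟨0, a, 0, b, c⟩ : WeierstrassCurve K).toAffine.Point =
      Nat.card (⟨0, a, 0, -9 * b, -(27 * c + 8 * a * b)⟩ : WeierstrassCurve K).toAffine.Point :=
  natCard_point_eq_of_isKernelXThreePair (isKernelXThreePair_mk hrel hΔ) h3

/-- The Vélu pair of `ThreeIsogeny` over a finite field of characteristic `≠ 2, 3`: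
`#E_{m,s}(k) = #E'_{m,s}(k)`. [cite: SilvermanAEC2009, Exercise 5.4(a)] -/
theorem IsVeluThreePair.natCard_point_eq {m s : K} (h : IsVeluThreePair m s W W')
    (h3 : (3 : K) ≠ 0) : Nat.card W.toAffine.Point = Nat.card W'.toAffine.Point :=
  natCard_point_eq_of_isKernelXThreePair h.isKernelXThreePair h3

end Finite

end WeierstrassCurve
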